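import Mathlib
import HarnessLib
import HarnessLib.Audit
import Summits.KontsevichZagierPeriods.Statement
import HarnessLib.Audit.Status.Attr

/-!
Route: CompiledSubstitutions

DORMANT since 2026-08-25T14:30:59Z (reconciler: no traction for 7.8 d (last activity item-evidence-added at 2026-08-17T19:16:55Z); parked, not closed — `ledger route dormant route-KontsevichZagierPeriods-CompiledSubstitutions --off` to ) — unstaffed, not closed; items shared with open routes are served there. `ledger route dormant <id> --off` reactivates.

# Route CompiledSubstitutions — transcendental substitutions through 1-dim algebraic groups compile
into rule 2); drive the schema through Legendre, Zhou–Wan, ζ(2k), reflection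

COMPILED SUBSTITUTIONS (engine route; card compiling-substitutions-unfolded-angles). It suffices to
show X := Conjecture 1 with
ALGEBRAIC data (the tree's `KZPeriodConjecture'`: any two ℚ-semialgebraic integral representations
of the same real number are
KZ-equivalent) — the form in which COMPILED move chains live: when a textbook proof of a period
identity substitutes x = φ(u)
with φ ∈ {sin, tan, exp, sn, ℘}, φ⁻¹ is an abelian integral u = ∫ω on a 1-dimensional real algebraic
group (circle, 𝔾_m,
E(ℝ)⁰), and the step compiles into rule 2) + rule 1a): genus 0 by t = tan(u/2) (the addition theorem
makes every constraint
linear in the angles ℚ-semialgebraic in t), genus ≥ 1 by carrying the point P(u) ∈ E, the invariant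
differential, the group
law and the cyclic order on the real component, and by UNFOLDING u = ∫_O^P ω as an extra fibre
variable when u enters
polynomially; Cauchy residues of algebraic 1-forms on semialgebraic loops compile to Stokes + the
standard [π]. Every
intermediate representation so produced is semialgebraic, never rational — hence X, not the literal
summit, is the working
target; X → KontsevichZagierPeriods is the tree's `kzPeriodConjecture'_iff_isRational` (one line).
Since rev 4 (route-choice, 2026-08-16) X is REACHED from the
items: cruxes 2–5 (the four compiled families) together with crux 6 `CompiledSectorKernel` — the
kernel conjecture of the
calculus RELATIVE to the compiled sector (GPC-strength, stated openly) — give X by pure logic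
(support `CompiledSectorGlue`).
The route drives the compilation schema through its first genus-1 instance with a pole (Legendre's
relation at every algebraic
modulus, McKean–Moll's contour proof with the incomplete integral of the 2nd kind as a period-type
PRIMITIVE), through the
schema's predicted boundary (the Zhou–Wan identity ∫₀¹K′³ = 2K(1/√2)⁴, known only through Bessel
moments / Tricomi pairing /
modular parametrisation — residue class ρ1–ρ2 of the card), and through two calibration families
that nobody has certified in
the fixed calculus (Euler's ζ(2k) ∈ ℚπ^{2k} for all k via Beukers–Kolk–Calabi–Elkies compiled by
tan-half-angle; Euler's
reflection B(a,1−a)·sin πa = π at rational a via t = s^q, cyclotomic partial fractions and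
finite-order Möbius rotations).
Lean: `∀ ⦃n m : ℕ⦄ (r : Literature.NumberTheory.Transcendental.KZ.IntegralRep n) (r' :
Literature.NumberTheory.Transcendental.KZ.IntegralRep m), r.value = r'.value →
Literature.NumberTheory.Transcendental.KZ.Equivalent r r'` (= item AlgebraicFormTarget; verbatim the
body of `Literature.NumberTheory.Transcendental.KZPeriodConjecture'`, Iff.rfl)

## Assembly
Deciding theorem (D-0027 §2.1, certified native since rev 2, unchanged): `closes (h₀ :
AlgebraicFormTarget) : KontsevichZagierPeriods` — drop the two IsRational hypotheses (the converse
is the tree's `Literature.NumberTheory.Transcendental.kzPeriodConjecture'_iff_isRational`). Since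
rev 4 (route-choice 2026-08-16, gate shape route.target-unreachable) the target has an in-edge: the
support item `CompiledSectorGlue : LegendreSector → ZhouWanKPrimeCubed → ZetaEvenBKC →
EulerReflectionRational → CompiledSectorKernel → AlgebraicFormTarget` is pure logic (instantiate the
kernel at S := KZ.relations, where its four realisability hypotheses ARE cruxes 2–5 verbatim; proved
in the planner's Sketch.lean, rc 0, axioms propext/Classical.choice/Quot.sound), so `closes ∘ glue`
decides the summit from cruxes 2–6 (`closes_of_cruxes` in the same Sketch.lean). ENGINE reading
(D-0019) kept: cruxes 2–5 drive the compilation schema through its delicate genus-1 instance (2),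
its predicted boundary (3) and two uncertified calibration families (4, 5); what they do not reach
is isolated, openly and at GPC strength, in crux 6 — Conjecture 1 MODULO the compiled sector — which
is where the schema predicts the residue class ρ1–ρ4 lives.

Rationale: WHY THIS LINE. Kontsevich–Zagier prove exactly one accessible identity inside rules 1)–3)
(KontsevichZagierPeriods2001 §1.2 pp. 9–10, read: Calabi's ζ(2) proof rewritten with x =
ξ²(1+η²)/(1+ξ²)); the card turns the example into a SCHEMA with a stated boundary — a transcendental
substitution x = φ(u) compiles iff φ⁻¹ is an abelian integral on a 1-dimensional real algebraic
group (genus 0: t = tan(u/2), the addition theorem makes linear angle constraints ℚ-semialgebraic;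
genus 1: point on E(ℝ)⁰ + group law + cyclic order, with u UNFOLDED as a fibre variable when it
enters polynomially; residues of algebraic forms = Stokes + the standard [π]) — and predicts that
Conjecture 1 (H21 reading) is decided on the residue class ρ1 Γ(s)-as-a-function (multiplication
formulas), ρ2 modular/CM arguments, ρ3 regularisation, ρ4 non-absolutely-convergent limits.
Imported: real algebraic geometry of 1-dim groups (addition theorems as semialgebraicity lemmas),
order-polytope combinatorics (Elkies2003, BeukersCalabiKolk1993), classical elliptic-function theory
read as Stokes with unfolded period-type primitives (MckeanMoll1999 §2.4, third proof, pp. 61–62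
read), and Zhou2013 (arXiv:1301.1735: Beltrami/Ramanujan rotations = algebraic changes of variables
on S²; Prop. 5.1 + Rem. 5 + §6 p. 29 pose the rules-proof of ∫K′³ = 2K(1/√2)⁴ as open, his proof
passing through Tricomi pairing and Bessel moments, i.e. exponential periods). What prior routes do
not do: LowDimension/Grothendieck/Neg file isolated calibration pairs; GaussManinCertificates
reaches Legendre by parameter transport; MultivaluedCoV treats correspondences sheet by sheet; none
types the substitution boundary or tests it on a printed open identity, and nobody has certified
ζ(2k) for k ≥ 2 or reflection at general rational argument in the fixed calculus. Negatives index: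
empty.

RANKED CRUXES. #0 AlgebraicFormTarget (target) — Conjecture 1 with algebraic (ℚ-semialgebraic) data
— the tree's KZPeriodConjecture', the form compiled chains live in (every compiled intermediate is
semialgebraic, never rational). (why it might fail: it IS Conjecture 1 (proved equivalent to the
summit in KZKernelConjectureForms): the GPC-strength barriers apply; false iff some identity of the
residue class ρ1–ρ4 (or any other) has no move chain.) [KontsevichZagierPeriods2001,
HuberMullerStachPeriods2017, CressonViusos2022]
#2 LegendreSector (crux) — SHARED with route GaussManinCertificates
(stmt-KontsevichZagierPeriods-3013, identical signature): for every real-algebraic m ∈ (0,1) the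
one-rep Legendre combination F_m = κₘ(x)e_{1−m}(y) + eₘ(x)κ_{1−m}(y) − κₘ(x)κ_{1−m}(y) on (0,1)²
(value KE′+EK′−KK′ = π/2; = (1 − m x² − (1−m) y²)/√((1−x²)(1−y²)(1−mx²)(1−(1−m)y²)), checked π/2 to
1e−8 at m = .36, 1/3, .9 here) is KZ-equivalent to [ℝ, 1/(2(1+x²))]. THIS route's mechanism (card D4
+ crux (c)): compile McKean–Moll's third proof — ∮ I·dx/y over a big circle on the plane cut along
[−1/k,−1]∪[1,1/k], I = incomplete 2nd-kind integral UNFOLDED as a fibre variable (u,x) ↦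
√((1−k²u²)/(1−u²)) on 0<u<x, y² = (1−x²)(1−k²x²); the residue at ∞ (I/y ~ 1/x) lands on the standard
2π after the compactifying CoV x ↦ 1/x; bank contributions are domain additivity. Anchor m = 1/2 is
Γ-free (Euler's ab = π/4 = Dirichlet's simplex, card legendre-lemniscatic-dirichlet-certificate;
Grothendieck item 0280). [difficulty: XL] (why it might fail: the unfolded primitive I has a pole at
∞ on the cut plane: compiling the residue needs an ALGEBRAIC function with the same principal part
and absolutely integrable bank remainders; if none exists without auxiliary poles on the cuts, only
parameter transport (GaussManin) reaches it.) [MckeanMoll1999, WhittakerWatson1927,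
KontsevichZagierPeriods2001, Zhou2013]
#3 ZhouWanKPrimeCubed (crux) — the Zhou–Wan identity 2K(1/√2)⁴ = ∫₀¹ K(√(1−k²))³ dk (=
Γ(1/4)⁸/(128π²) = 23.63409001615…, both sides checked here) as two 4-dim semialgebraic cube
representations — [(0,1)⁴, 2∏ᵢ((1−zᵢ²)(1−zᵢ²/2))^{−1/2}] ~ [(0,1)⁴,
∏_{i<3}((1−zᵢ²)(1−(1−z₃²)zᵢ²))^{−1/2}] — is KZ-accessible. Zhou2013 Prop. 5.1/Rem. 5/§6 ask in print
for a proof "by finite steps of algebraic manipulations … and the Newton–Leibniz formula"; every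
known proof uses Tricomi pairing + Bessel moments (exponential periods) or lattice sums/modular
forms — the card's residue class ρ1/ρ2, i.e. exactly where the schema predicts accessibility is
decided. Candidate compiled line: Zhou's Beltrami rotations (p. 16) ARE algebraic CoVs on S² with
the azimuth unfolded; the Tricomi/Parseval step is the non-compiling one. [difficulty: open-problem]
(why it might fail: all printed proofs leave the algebraic class (Bessel moments = exponential
periods; theta/lattice sums = modular, ρ2); a weight-4 CM identity may need a correspondence on a
product of four lemniscatic curves that no 1-dim-group substitution supplies.) [Zhou2013,
arXiv:1301.1735, KontsevichZagierPeriods2001]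
#4 ZetaEvenBKC (crux) — Euler's ζ(2k) ∈ ℚπ^{2k} is ACCESSIBLE for every k ≥ 1 (card D2): ∃ q ∈ ℚ
with [(0,1)^{2k}, 1/(1−∏xᵢ²)] ~ [(0,1)^{2k}, q·∏1/(1+xᵢ²)] (values λ(2k) = (1−4^{−k})ζ(2k) =
q(π/4)^{2k}, q = (−1)^{k+1}(4^k−1)2^{4k−1}B_{2k}/(2k)! = 2, 8/3, 64/15, 6.9079… checked). Chain: the
Beukers–Kolk–Calabi map xᵢ = sin uᵢ/cos uᵢ₊₁ composed with uᵢ = 2 arctan tᵢ is RATIONAL over ℚ with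
Jacobian (1−∏xᵢ²)·∏2/(1+tᵢ²) (even n), a bijection from T(P) = {t ∈ (0,1)^{2k} : tᵢ+tᵢ₊₁+tᵢtᵢ₊₁ < 1
cyclically} onto the open cube — ONE changeOfVariablesRel; Elkies' reflections uᵢ ↦ π/2−uᵢ (i even;
t ↦ (1−t)/(1+t), Möbius preserving 2dt/(1+t²)) dissect T(P) into k·E_{2k−1} (= 1, 4, 48, 1088
checked) order simplices {0<t_σ1<…<t_σ2k<1}, each a coordinate permutation of one; (2k)!·[Δ, g] ~
[(0,1)^{2k}, g] by domain additivity + permutation CoVs; ℤ-multiples n[σ,f] ~ [σ,nf] by integrand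
additivity. KZ did k = 1 (§1.2 pp. 9–10). [deps: TanHalfAngleSemialgebraic] [difficulty: L] (why it
might fail: uniform-in-k bijectivity of the BKC map onto the open cube must be proved inside
changeOfVariablesRel (BKC's proof is indirect), and Elkies' dissection must be a null-overlap union
of ℚ-semialgebraic cells for every k; a k-dependent cell count is fine, a non-injective sheet is
not.) [BeukersCalabiKolk1993, Elkies2003, KontsevichZagierPeriods2001]
#5 EulerReflectionRational (crux) — Euler reflection at every rational a ∈ (0,1) is accessible (card
D3): [(0,1), sin(πa)·x^{a−1}(1−x)^{−a}] ~ [closed unit disc, 1] (B(a,1−a)·sin πa = π). Chain: t =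
x/(1−x) then t = s^q (a = p/q) makes the integrand rational: q s^{p−1}/(1+s^q) on (0,∞); fold (1,∞)
onto (0,1) by s ↦ 1/s BEFORE partial fractions (absolute convergence piecewise); partial fractions
over ℚ(cos π/q) (rule 1b); log parts cancel pairwise by the symmetry j ↔ q+1−j (equal arguments,
trivial multiplicative relations only); arctan parts are rational multiples of π at tan of rational
angles, realised by finite-order Möbius rotations t ↦ (t cos θ + sin θ)/(−t sin θ + cos θ)
preserving dt/(1+t²) and tiling the circle; algebraic coefficients merge by integrand additivity of
constants on the disc. [deps: PiNormalisation] [difficulty: M] (why it might fail: the pairwise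
cancellation of the log terms Σ αⱼ log(2−2cos θⱼ) with algebraic αⱼ must be EXACT term by term; if
only the ℚ̄-linear combination vanishes, realising it needs Baker-type bookkeeping (LowDimension
item 0405) and the item is accessible only relative to baker.) [AndrewsAskeyRoy1999,
KontsevichZagierPeriods2001, Baker1975]
#6 CompiledSectorKernel (crux; NEW at rev 4, route-choice 2026-08-16) — the kernel conjecture of the
calculus RELATIVE TO THE COMPILED SECTOR: for every subgroup S of formal ℤ-combinations of
representations with KZ.relations ≤ S that realises the four compiled families — the signatures of
LegendreSector, ZhouWanKPrimeCubed, ZetaEvenBKC, EulerReflectionRational verbatim with each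
conclusion `KZ.Equivalent r r′` read as `[r] − [r′] ∈ S` — S contains [r] − [r′] for every
equal-valued pair. At S := KZ.relations the hypotheses are cruxes 2–5 and the conclusion is
AlgebraicFormTarget (support CompiledSectorGlue); at S := closure(relations ∪ the true relators of
the four families) it is Conjecture 1 modulo the compiled sector, the honest residual of the engine,
where the schema predicts the residue class ρ1–ρ4 lives. GPC-strength, stated openly
(AlgebraicFormTarget → it in one line; it + cruxes 2–5 → AlgebraicFormTarget); not vacuous if a crux
fails (S arbitrary). Do not staff ahead of ranks 2–5; its informative event is a refutation.
[difficulty: open-problem] (why it might fail: GPC-strength: modulo cruxes 2–5 it is Conjecture 1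
itself; false iff some equal-valued pair off the four compiled families has no move chain — Neg's
Gauss triplication (stmt-0311/0312), a regularised-MZV or class-number > 1 Chowla–Selberg identity.)
[KontsevichZagierPeriods2001, HuberMullerStachPeriods2017, CressonViusos2022]
#9 PiNormalisation (support) — KZ eq. (1) (card D1): the three 1-dim textbook representations of π —
[ℝ, 1/(1+x²)], [(−1,1), 1/√(1−x²)], [(−1,1), 2√(1−x²)] — are each KZ-equivalent to the
closed-unit-disc rep [x²+y²≤1, 1] (KZ: "easily related"; polar area r dr dθ = d(r²/2)dθ with x =
tan(θ/2): (p,q) ↦ (q/(√(p²+q²)+p), (p²+q²)/(1+t²)) has Jacobian 1 on the slit disc; Newton–Leibniz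
with primitive x√(1−x²) is KZ's own one-move example). Needed by every crux that lands on π.
[difficulty: provable-now] [KontsevichZagierPeriods2001]
#9 FagnanoDoubling (support) — genus-1 calibration of "group law = ONE change of variables" (card
D4): 2∫₀^{1/2} dr/√(1−r⁴) = ∫₀^{4√15/17} dr/√(1−r⁴) (both 1.0064188863…, checked): the lemniscatic
doubling r ↦ 2r√(1−r⁴)/(1+r⁴) is ℚ-semialgebraic, injective on (0,1/2) (below the critical point
√(√2−1)), pulls dr/√(1−r⁴) back to 2dr/√(1−r⁴); one changeOfVariablesRel + integrand bookkeeping.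
[difficulty: provable-now] [MckeanMoll1999, KontsevichZagierPeriods2001]
#9 TanHalfAngleSemialgebraic (support) — the genus-0 compilation lemma (card U1): for every rational
angle polyhedron A = {u ∈ (−π,π)ⁿ : Σᵢ aⱼᵢuᵢ < bⱼπ ∀j} (a ∈ ℤ^{m×n}, b ∈ ℚ^m), its image under t =
tan(u/2) coordinatewise is ℚ-semialgebraic. Proof: e^{iΣaᵢuᵢ} = ∏((1+itᵢ)/(1−itᵢ))^{aᵢ}, so each
level set {Σaᵢuᵢ = bⱼπ + 2πℓ} is open-closed in a real algebraic set defined over ℚ(cos bⱼπ, sin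
bⱼπ) ⊂ ℚ̄∩ℝ, hence a union of its (finitely many, semialgebraic) connected components; the sublevel
set is a union of components of the complement; real-algebraic parameters are ℚ-definable.
[difficulty: M] [BochnakCosteRoy1998, KontsevichZagierPeriods2001, Elkies2003]
#9 CompiledSectorGlue (support; NEW at rev 4, route-choice 2026-08-16 — gate shape
route.target-unreachable: 'no item concludes the target') — LegendreSector → ZhouWanKPrimeCubed →
ZetaEvenBKC → EulerReflectionRational → CompiledSectorKernel → AlgebraicFormTarget. Pure logic,
provable now: instantiate CompiledSectorKernel at S := KZ.relations (le_rfl); its realisability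
hypotheses are then cruxes 2–5 verbatim (`KZ.Equivalent` unfolds by definition to membership in
KZ.relations) and its conclusion is the target. Proved in the planner's Sketch.lean
(`compiledSectorGlue_holds`, rc 0, axioms standard; `closes_of_cruxes := closes ∘ glue`).
[difficulty: provable-now] [KontsevichZagierPeriods2001]

TWO-LAYER PLAN. Foreseen glued splits (nothing filed now): ZetaEvenBKC ⇐ BKCBijection (the rational
map T(P) → cube is a bijection with the stated Jacobian, ∀k) → ElkiesDissection (T(P) = null-overlap
union of k·E_{2k−1} permuted order simplices) → ZetaEvenBKC; LegendreSector ⇐ UnfoldedContour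
(Stokes on the cut plane with I unfolded) → ResidueAtInfinity (principal part algebraic, remainder
absolutely integrable) → LegendreSector; EulerReflectionRational ⇐ CyclotomicPartialFractions →
MoebiusTiling → EulerReflectionRational.

KILL CRITERIA. Refutation of ZetaEvenBKC, EulerReflectionRational, PiNormalisation or
FagnanoDoubling would exhibit a defect of the FIXED calculus on a textbook identity: report to
operator, close `refuted:<Decl>`. Refutation of LegendreSector or ZhouWanKPrimeCubed refutes the
summit itself (hand the invariant to Neg; close all positive routes). So does a refutation of
CompiledSectorKernel — an additive invariant of ℚ-semialgebraic representations vanishing on the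
four move sets and on the four compiled families yet separating one equal-valued pair: hand it to
Neg. A rules-proof of ZhouWanKPrimeCubed or of Neg/MultivaluedCoV's TriplicationAccessible (0312) by
a chain with no 1-dim-group substitution kills the residue classification's predictive value: keep
ranks 4–5 as calibration, then close `superseded --by` the route that produced the chain.
LegendreSector proved by transport (GaussManin) does not moot crux 2 for this route's purpose only
if the residue compilation is still wanted as a second proof — it is not: the item closes for
everyone and this route re-ranks.

NOT DECOMPOSED YET. The general compilation meta-theorem (a schema, instantiated item by item, never
an item); genus-1 unfolded angles with u polynomial (no classical identity needs it before Legendre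
lands); ρ3/ρ4 tests (regularised MZV — Grothendieck 0275; log-sine/Catalan — LiouvilleUnfolding);
Chowla–Selberg with class number > 1 (ρ2; statement too constant-heavy to type safely today); the
BKC bijection and Elkies dissection lemmas (layer-2 children of ZetaEvenBKC, above).
CompiledSectorKernel is never split (GPC-strength residual): it shrinks only by compiling further
families, which a tenure planner files as new cruxes plus a new, weaker kernel item and glue — never
by restating this one.

CHEAPEST FALSIFIER. (i) k = 2 of ZetaEvenBKC by certified computation: is t ↦ x (BKC ∘
tan-half-angle, explicit rational map) injective on T(P) ⊂ (0,1)⁴ with image of full measure in the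
cube and Jacobian (1−∏x²)∏2/(1+tᵢ²)? (value bookkeeping done here: λ(4) = π⁴/96, N₄ = 4.) (ii)
Literature lookup for crux 3: has a rules/algebraic proof of ∫₀¹K′³ dk = 2K(1/√2)⁴ appeared since
Zhou2013 (Rogers–Wan–Zucker 2015; Borwein et al., Lattice Sums Then and Now 2013, both cited by Zhou
as modular/lattice-sum proofs)? Remote APIs were rate-limited this session; galaxy/hybrid searches
found none.

NUMBERS. λ(2k)(2k)!/(π/2)^{2k} = k·E_{2k−1} = 1, 4, 48, 1088 (k = 1..4; tangent numbers 1, 2, 16,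
272); q_k = 2, 8/3, 64/15, 6.90794; Γ(1/4)⁸/(128π²) = 23.634090016154; Fagnano endpoint 4√15/17 =
0.91129019911; Legendre combined integrand integrates to 1.5707963 at m ∈ {0.36, 1/3, 0.9}. Items at
open: 9; after rev 4 (route-choice): 11 (1 target, 5 cruxes, 4 supports, 1 assembly).

DEFINITION REQUESTS. None: every statement elaborates over KZCalculus + Mathlib (Sketch.lean rc 0,
imports Mathlib + Summits.KontsevichZagierPeriods.Statement only; `KZ.piRep` of KZProduct
deliberately not used, the disc rep is quantified instead). Rev 4 items CompiledSectorKernel /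
CompiledSectorGlue elaborate against the route file itself (folder Sketch.lean imports
Summits.KontsevichZagierPeriods.KontsevichZagierPeriods.Theses.CompiledSubstitutions; rc 0) and need
no definition.

Novelty: NOVELTY (search-before-claim, 2026-08-15; card graded new-combination by refuter-novelty-audit-5).
Searched: held KZ text
paper:url-4812d7ce6862 pp. 9–10 (Calabi proof inside the rules, READ) and p. 5 eq. (1); lit search
--hybrid "Beukers Kolk
Calabi … zeta even" (held hits are textbooks: Finch, Eie, Aigner–Ziegler via galaxy); lit galaxy
search --star all
"Beukers, Calabi and Kolk" (Proofs from THE BOOK, Hata — expositions of the k = 1 substitution, no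
rules reading), "conjecture
of Kontsevich and Zagier" (cached: computability LNCS 13359; arXiv:1506.00318 Zhou —
Kontsevich–Zagier integrals for
Legendre–Ramanujan curves), "Zagier period conjecture" (0 hits); crossref for Elkies2003
(doi:10.2307/3647742) and Zhou2013
(doi:10.1007/s11139-013-9502-2); arXiv:1301.1735 READ (p. 16 Beltrami rotations = algebraic changes
of variables on S² with
the azimuth integrated out; p. 23 Prop. 5.1 + Rem. 5; p. 29 §6: "identities for periods can be
proved by 'algebraic means'
… the analytic proof we produced … does not fall into such a category: we have invoked Bessel
functions, which are
'exponential periods'"); McKean–Moll pp. 59–62 READ (three proofs of Legendre: Wronskian/transport,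
Γ(1/4) special value,
contour integral of I·dx/y); the tree's parallel routes GaussManinCertificates (Legendre by
transport — item SHARED, not
duplicated), MultivaluedCoV (group laws/correspondences as sums of sheets; circle rung only cited,
no ζ(2k) or reflection
item), LiouvilleUnfolding (unfolded arctan/arc  [refs: 10.2307/3647742, 10.1007/s11139-013-9502-2, 1506.00318, 1301.1735, paper:url-4812d7ce6862, doi:10.2307/3647742, doi:10.1007/s11139-013-9502-2, Elkies2003, Zhou2013, KontsevichZagierPeriods2001, BeukersCalabiKolk1993]

Barriers (technique_class: proof-compilation, unfolding, residue-classification): - technique_class: proof-compilation, unfolding, residue-classification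
BARRIERS (catalogue Literature/Barriers/KontsevichZagierPeriods: 4 topics, 6 tagged decls;
technique_class of this route:
proof-compilation, transcendental-substitution, unfolding, residue-classification).
- Literature.Barriers.KontsevichZagierPeriods.noSemialgebraicPrimitive_inv_sub_two : EVADED for
substitutions and DISSOLVED
for period-type primitives — no primitive is integrated out; u = ∫ω is unfolded as a semialgebraic
fibre variable (the
barrier file's own evasion "add variables", made systematic). It still bites at ρ3 (regularised
primitives) and at the pole of
I·dx/y in LegendreSector's contour proof (why-might-fail of crux 2), which the route flags rather
than evades.
- Literature.Barriers.KontsevichZagierPeriods.kzConjecture_implies_oddZetaAlgIndep ,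
Literature.Barriers.KontsevichZagierPeriods.kzConjecture_implies_twoPiI_log_algIndep ,
Literature.Barriers.KontsevichZagierPeriods.kzConjecture_implies_ellipticPeriods_algIndep : NOT
ENGAGED by the cruxes — they
compile GIVEN proofs of GIVEN true identities (Euler, Legendre, Zhou–Wan are theorems); no
transcendence or independence
statement is asserted or needed. They DO apply to the target X (= Conjecture 1) itself: the route
does not claim to prove X,
only to map the accessible/inaccessible boundary; the bet is that the boundary is the residue class.
- Literature.Barriers.KontsevichZagierPeriods.cressonViuSos_prop_3_2 : not engaged — every chain

History (route lifecycle, newest last):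
- 2026-08-16T02:17:47Z · AUTO-CRUX: 1 conjecture-grade item(s) promoted to crux (AlgebraicFormTarget) — refuter vetting / tiering apply (operator:999:1362873)
- 2026-08-16T03:27:32Z · rev 5: restated Assembly (stmt-KontsevichZagierPeriods-3387) — route-choice follow-up (unit rchoice-KontsevichZagierPeriods-Compil-62d2cb9f, 2026-08-16): rev 4 re-ran the ground probe and the rev-0 Assembly item stmt-3387 ( (planner-rchoice-KontsevichZagierPeriods-Compil-62d2cb9f-0)
- 2026-08-16T04:08:00Z · AUTO-CRUX (backfill): AlgebraicFormTarget — hypotheses of the deciding theorem that nothing in the route derives are cruxes (operator:999:1085951)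
- 2026-08-25T14:30:59Z · DORMANT — reconciler: no traction for 7.8 d (last activity item-evidence-added at 2026-08-17T19:16:55Z); parked, not closed — `ledger route dormant route-KontsevichZagier (operator:999:1294297)

sub-problem: KontsevichZagierPeriods · status: dormant · opened planner-plancard-KontsevichZagierPeriods-Kont-439dfc7c-0 2026-08-15T11:17:17Z · rev 5 · ledger route-KontsevichZagierPeriods-CompiledSubstitutions
GENERATED by the gate from the ledger (D-0016/17). Provers cite these decls: `theorem foo : Summit.KontsevichZagierPeriods.KontsevichZagierPeriods.Theses.CompiledSubstitutions.<Decl> := …` in Summits/KontsevichZagierPeriods/KontsevichZagierPeriods/Theorems/<Name>.lean.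
-/

namespace Summit.KontsevichZagierPeriods.KontsevichZagierPeriods.Theses.CompiledSubstitutions

open scoped BigOperators Topology Manifold Classical MeasureTheory ProbabilityTheory Matrix InnerProductSpace ComplexConjugate ContinuousMap
open Filter Set Function TopologicalSpace MeasureTheory

attribute [summit_statement] _root_.KontsevichZagierPeriods

open Literature Periods

/-- item stmt-KontsevichZagierPeriods-3380 · crux (kind.auto-crux: conjecture-grade) · rank 0 · open · by planner
why it might fail: it IS Conjecture 1 (verbatim the body of the tree's KZPeriodConjecture', proved ≡ summit in KZKernelConjectureForms): the GPC-strength barriers apply; false iff some identity of the residue class ρ1–ρ4 (or any other) has no move chain.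
sources: KontsevichZagierPeriods2001, HuberMullerStachPeriods2017, CressonViusos2022
[target] Conjecture 1 with algebraic (ℚ-semialgebraic) data — the tree's KZPeriodConjecture', the
form compiled chains live in (every compiled intermediate is semialgebraic, never rational). -/
@[route_item "route-KontsevichZagierPeriods-CompiledSubstitutions", crux]
def AlgebraicFormTarget : Prop :=
  ∀ ⦃n m : ℕ⦄ (r : Literature.NumberTheory.Transcendental.KZ.IntegralRep n) (r' : Literature.NumberTheory.Transcendental.KZ.IntegralRep m), r.value = r'.value → Literature.NumberTheory.Transcendental.KZ.Equivalent r r'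

/-- item stmt-KontsevichZagierPeriods-3013 · crux · rank 2 · open · by planner
why it might fail: the unfolded primitive I has a pole at ∞ on the cut plane: compiling the residue needs an ALGEBRAIC function with the same principal part and absolutely integrable bank remainders; if none exists without auxiliary poles on the cuts, only parameter transport (GaussManin) reaches it.
sources: MckeanMoll1999, WhittakerWatson1927, KontsevichZagierPeriods2001, Zhou2013
[crux] the Legendre sector of Conjecture 1: for every real-algebraic parameter m ∈ (0,1), the
one-representation Legendre combination F_m(x,y) = κₘ(x)e_{1−m}(y) + eₘ(x)κ_{1−m}(y) −
κₘ(x)κ_{1−m}(y) on (0,1)² (κₘ = 1/√((1−x²)(1−mx²)), eₘ = √(1−mx²)/√(1−x²); value K E′ + E K′ − K K′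
= π/2, checked to 1e−13 at m = 1/2, 1/4, 1/3, 9/10) is KZ-equivalent to ∫_ℝ dx/(2(1+x²)). Card test
"Legendre at generic algebraic k = d/dk-identity + lemniscatic value": LegendreModulusPropagation +
the CM fibre m = 1/2 (Grothendieck item stmt-KontsevichZagierPeriods-0280, same value, integrand
symmetrised by one swap CoV). [deps: LegendreModulusPropagation] [difficulty: XL] -/
@[route_item "route-KontsevichZagierPeriods-CompiledSubstitutions"]
def LegendreSector : Prop :=
  ∀ (F : ℝ → (Fin 2 → ℝ) → ℝ), (∀ (m : ℝ) (x : Fin 2 → ℝ), F m x = 1 / Real.sqrt ((1 - x 0 ^ 2) * (1 - m * x 0 ^ 2)) * (Real.sqrt (1 - (1 - m) * x 1 ^ 2) / Real.sqrt (1 - x 1 ^ 2)) + Real.sqrt (1 - m * x 0 ^ 2) / Real.sqrt (1 - x 0 ^ 2) * (1 / Real.sqrt ((1 - x 1 ^ 2) * (1 - (1 - m) * x 1 ^ 2))) - 1 / Real.sqrt ((1 - x 0 ^ 2) * (1 - m * x 0 ^ 2)) * (1 / Real.sqrt ((1 - x 1 ^ 2) * (1 - (1 - m) * x 1 ^ 2))))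 → ∀ (m : ℝ), IsAlgebraic ℚ m → m ∈ Set.Ioo (0 : ℝ) 1 → ∀ (r : Literature.NumberTheory.Transcendental.KZ.IntegralRep 2) (r' : Literature.NumberTheory.Transcendental.KZ.IntegralRep 1), r.domain = {x | ∀ i, x i ∈ Set.Ioo (0 : ℝ) 1} → Set.EqOn r.integrand (F m) r.domain → r'.domain = Set.univ → Set.EqOn r'.integrand (fun x => 1 / (2 * (1 + x 0 ^ 2))) r'.domain → Literature.NumberTheory.Transcendental.KZ.Equivalent r r'

/-- item stmt-KontsevichZagierPeriods-3381 · crux · rank 3 · open · by planner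
why it might fail: all printed proofs leave the algebraic class (Bessel moments = exponential periods; theta/lattice sums = modular, ρ2); a weight-4 CM identity may need a correspondence on a product of four lemniscatic curves that no 1-dim-group substitution supplies.
sources: Zhou2013, arXiv:1301.1735, KontsevichZagierPeriods2001
[crux] the Zhou–Wan identity 2K(1/√2)⁴ = ∫₀¹ K(√(1−k²))³ dk (= Γ(1/4)⁸/(128π²) = 23.63409001615…,
both sides checked here) as two 4-dim semialgebraic cube representations — [(0,1)⁴,
2∏ᵢ((1−zᵢ²)(1−zᵢ²/2))^{−1/2}] ~ [(0,1)⁴, ∏_{i<3}((1−zᵢ²)(1−(1−z₃²)zᵢ²))^{−1/2}] — is KZ-accessible.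
Zhou2013 Prop. 5.1/Rem. 5/§6 ask in print for a proof "by finite steps of algebraic manipulations …
and the Newton–Leibniz formula"; every known proof uses Tricomi pairing + Bessel moments
(exponential periods) or lattice sums/modular forms — the card's residue class ρ1/ρ2, i.e. exactly
where the schema predicts accessibility is decided. Candidate compiled line: Zhou's Beltrami
rotations (p. 16) ARE algebraic CoVs on S² with the azimuth unfolded; the Tricomi/Parseval step is
the non-compiling one. [difficulty: open-problem] -/
@[route_item "route-KontsevichZagierPeriods-CompiledSubstitutions"]
def ZhouWanKPrimeCubed : Prop :=
  ∀ (r r' : Literature.NumberTheory.Transcendental.KZ.IntegralRep 4), r.domain = {z | ∀ i, z i ∈ Set.Ioo (0:ℝ) 1} → Set.EqOn r.integrand (fun z => 2 * ∏ i : Fin 4, 1 / Real.sqrt ((1 - z i ^ 2) * (1 - z i ^ 2 / 2))) r.domain → r'.domain = {z | ∀ i, z i ∈ Set.Ioo (0:ℝ) 1} → Set.EqOn r'.integrand (fun z => ∏ i : Fin 3, 1 / Real.sqrt ((1 - z (Fin.castSucc i) ^ 2) * (1 - (1 - z 3 ^ 2) * z (Fin.castSucc i) ^ 2))) r'.domain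 → Literature.NumberTheory.Transcendental.KZ.Equivalent r r'

/-- item stmt-KontsevichZagierPeriods-3382 · crux · rank 4 · closed · proved by Summit.KontsevichZagierPeriods.Theorems.CompiledSubstitutionsZetaEvenBKC.zetaEvenBKC_proof @ a007da197adf (prover) · by planner
why it might fail: uniform-in-k bijectivity of the BKC map onto the open cube must be proved inside changeOfVariablesRel (BKC's proof is indirect), and Elkies' dissection must be a null-overlap union of ℚ-semialgebraic cells for every k; a k-dependent cell count is fine, a non-injective sheet is not.
sources: BeukersCalabiKolk1993, Elkies2003, KontsevichZagierPeriods2001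
[crux] Euler's ζ(2k) ∈ ℚπ^{2k} is ACCESSIBLE for every k ≥ 1 (card D2): ∃ q ∈ ℚ with [(0,1)^{2k},
1/(1−∏xᵢ²)] ~ [(0,1)^{2k}, q·∏1/(1+xᵢ²)] (values λ(2k) = (1−4^{−k})ζ(2k) = q(π/4)^{2k}, q =
(−1)^{k+1}(4^k−1)2^{4k−1}B_{2k}/(2k)! = 2, 8/3, 64/15, 6.9079… checked). Chain: the
Beukers–Kolk–Calabi map xᵢ = sin uᵢ/cos uᵢ₊₁ composed with uᵢ = 2 arctan tᵢ is RATIONAL over ℚ with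
Jacobian (1−∏xᵢ²)·∏2/(1+tᵢ²) (even n), a bijection from T(P) = {t ∈ (0,1)^{2k} : tᵢ+tᵢ₊₁+tᵢtᵢ₊₁ < 1
cyclically} onto the open cube — ONE changeOfVariablesRel; Elkies' reflections uᵢ ↦ π/2−uᵢ (i even;
t ↦ (1−t)/(1+t), Möbius preserving 2dt/(1+t²)) dissect T(P) into k·E_{2k−1} (= 1, 4, 48, 1088
checked) order simplices {0<t_σ1<…<t_σ2k<1}, each a coordinate permutation of one; (2k)!·[Δ, g] ~
[(0,1)^{2k}, g] by domain additivity + permutation CoVs; ℤ-multiples n[σ,f] ~ [σ,nf] by integrand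
additivity. KZ did k = 1 (§1.2 pp. 9–10). [deps: TanHalfAngleSemialgebraic] [difficulty: L] -/
@[route_item "route-KontsevichZagierPeriods-CompiledSubstitutions"]
def ZetaEvenBKC : Prop :=
  ∀ k : ℕ, 1 ≤ k → ∃ q : ℚ, ∀ (r r' : Literature.NumberTheory.Transcendental.KZ.IntegralRep (2 * k)), r.domain = {x | ∀ i, x i ∈ Set.Ioo (0:ℝ) 1} → Set.EqOn r.integrand (fun x => 1 / (1 - ∏ i, x i ^ 2)) r.domain → r'.domain = {x | ∀ i, x i ∈ Set.Ioo (0:ℝ) 1} → Set.EqOn r'.integrand (fun x => (q : ℝ) * ∏ i, 1 / (1 + x i ^ 2)) r'.domain → Literature.NumberTheory.Transcendental.KZ.Equivalent r r'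

/-- item stmt-KontsevichZagierPeriods-3383 · crux · rank 5 · open · by planner
why it might fail: the pairwise cancellation of the log terms Σ αⱼ log(2−2cos θⱼ) with algebraic αⱼ must be EXACT term by term; if only the ℚ̄-linear combination vanishes, realising it needs Baker-type bookkeeping (LowDimension item 0405) and the item is accessible only relative to baker.
sources: AndrewsAskeyRoy1999, KontsevichZagierPeriods2001, Baker1975
[crux] Euler reflection at every rational a ∈ (0,1) is accessible (card D3): [(0,1),
sin(πa)·x^{a−1}(1−x)^{−a}] ~ [closed unit disc, 1] (B(a,1−a)·sin πa = π). Chain: t = x/(1−x) then t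
= s^q (a = p/q) makes the integrand rational: q s^{p−1}/(1+s^q) on (0,∞); fold (1,∞) onto (0,1) by s
↦ 1/s BEFORE partial fractions (absolute convergence piecewise); partial fractions over ℚ(cos π/q)
(rule 1b); log parts cancel pairwise by the symmetry j ↔ q+1−j (equal arguments, trivial
multiplicative relations only); arctan parts are rational multiples of π at tan of rational angles,
realised by finite-order Möbius rotations t ↦ (t cos θ + sin θ)/(−t sin θ + cos θ) preserving
dt/(1+t²) and tiling the circle; algebraic coefficients merge by integrand additivity of constants
on the disc. [deps: PiNormalisation] [difficulty: M] -/
@[route_item "route-KontsevichZagierPeriods-CompiledSubstitutions"]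
def EulerReflectionRational : Prop :=
  ∀ a : ℚ, 0 < a → a < 1 → ∀ (r : Literature.NumberTheory.Transcendental.KZ.IntegralRep 1) (p : Literature.NumberTheory.Transcendental.KZ.IntegralRep 2), r.domain = {x | x 0 ∈ Set.Ioo (0:ℝ) 1} → Set.EqOn r.integrand (fun x => Real.sin (Real.pi * a) * (x 0) ^ ((a : ℝ) - 1) * (1 - x 0) ^ (-(a : ℝ))) r.domain → p.domain = {z | z 0 ^ 2 + z 1 ^ 2 ≤ 1} → Set.EqOn p.integrand (fun _ => 1) p.domain → Literature.NumberTheory.Transcendental.KZ.Equivalent r p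

/-- item stmt-KontsevichZagierPeriods-14366 · crux · rank 6 · open · by planner
why it might fail: GPC-strength: modulo cruxes 2–5 it is Conjecture 1 itself (target → it in one line); false iff some equal-valued pair off the four compiled families has no move chain — Neg's Gauss triplication (stmt-0311/0312), a regularised-MZV or class-number>1 Chowla–Selberg identity.
sources: KontsevichZagierPeriods2001, HuberMullerStachPeriods2017, CressonViusos2022
[crux] KERNEL RELATIVE TO THE COMPILED SECTOR (NEW at rev 4, route-choice 2026-08-16: gives the
target AlgebraicFormTarget an in-edge; GPC-strength, stated openly). For every subgroup S of formal
ℤ-combinations of integral representations with KZ.relations ≤ S (S contains the four moves) which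
REALISES the route's four compiled families — the four hypotheses are the signatures of
LegendreSector, ZhouWanKPrimeCubed, ZetaEvenBKC and EulerReflectionRational verbatim, each
conclusion `KZ.Equivalent r r'` replaced by `KZ.of r − KZ.of r' ∈ S` — S contains KZ.of r − KZ.of r'
for EVERY pair of representations with r.value = r'.value. Readings: at S := KZ.relations the four
hypotheses ARE cruxes 2–5 and the conclusion is AlgebraicFormTarget (support CompiledSectorGlue,
pure logic); at S := closure(relations ∪ the true relators of the four families) it is Conjecture 1
MODULO the compiled sector — the honest residual of this engine route, where the card's schema
predicts that whatever compiled substitutions cannot decide lives (residue class ρ1 Γ-multiplication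
formulas, ρ2 CM/modular, ρ3 regularisation, ρ4 conditionally convergent limits; first concrete
tests: Neg's Gauss triplication stmt-0 -/
@[route_item "route-KontsevichZagierPeriods-CompiledSubstitutions"]
def CompiledSectorKernel : Prop :=
  ∀ S : AddSubgroup Literature.NumberTheory.Transcendental.KZ.FormalRep, Literature.NumberTheory.Transcendental.KZ.relations ≤ S → (∀ (F : ℝ → (Fin 2 → ℝ) → ℝ), (∀ (m : ℝ) (x : Fin 2 → ℝ), F m x = 1 / Real.sqrt ((1 - x 0 ^ 2) * (1 - m * x 0 ^ 2)) * (Real.sqrt (1 - (1 - m) * x 1 ^ 2) / Real.sqrt (1 - x 1 ^ 2)) + Real.sqrt (1 - m * x 0 ^ 2) / Real.sqrt (1 - x 0 ^ 2) * (1 / Real.sqrt ((1 - x 1 ^ 2) * (1 - (1 - m) * x 1 ^ 2))) - 1 / Real.sqrt ((1 - x 0 ^ 2) * (1 - m * x 0 ^ 2)) * (1 / Real.sqrt ((1 - x 1 ^ 2) * (1 - (1 - m) * x 1 ^ 2)))) → ∀ (m : ℝ), IsAlgebraic ℚ m → m ∈ Set.Ioo (0 : ℝ) 1 → ∀ (r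 : Literature.NumberTheory.Transcendental.KZ.IntegralRep 2) (r' : Literature.NumberTheory.Transcendental.KZ.IntegralRep 1), r.domain = {x | ∀ i, x i ∈ Set.Ioo (0 : ℝ) 1} → Set.EqOn r.integrand (F m) r.domain → r'.domain = Set.univ → Set.EqOn r'.integrand (fun x => 1 / (2 * (1 + x 0 ^ 2))) r'.domain → Literature.NumberTheory.Transcendental.KZ.of r - Literature.NumberTheory.Transcendental.KZ.of r' ∈ S) → (∀ (r r' : Literature.NumberTheory.Transcendental.KZ.IntegralRep 4), r.domain = {z | ∀ i, z i ∈ Set.Ioo (0:ℝ) 1} → Set.EqOn r.integrand (fun z => 2 * ∏ i : Fin 4, 1 / Real.sqrt ((1 - z i ^ 2) * (1 - z i ^ 2 / 2))) r.domain → r'.domain = {z | ∀ i, z i ∈ Set.Ioo (0:ℝ) 1} → Set.EqOn r'.integrand (fun z => ∏ i : Fin 3, 1 / Real.sqrt ((1 - z (Fin.castSucc i) ^ 2) * (1 - (1 - z 3 ^ 2) * z (Fin.castSucc i) ^ 2))) r'.domain → Literature.NumberTheory.Transcendental.KZ.of r - Literature.NumberTheory.Transcendental.KZ.of r' ∈ S)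 → (∀ k : ℕ, 1 ≤ k → ∃ q : ℚ, ∀ (r r' : Literature.NumberTheory.Transcendental.KZ.IntegralRep (2 * k)), r.domain = {x | ∀ i, x i ∈ Set.Ioo (0:ℝ) 1} → Set.EqOn r.integrand (fun x => 1 / (1 - ∏ i, x i ^ 2)) r.domain → r'.domain = {x | ∀ i, x i ∈ Set.Ioo (0:ℝ) 1} → Set.EqOn r'.integrand (fun x => (q : ℝ) * ∏ i, 1 / (1 + x i ^ 2)) r'.domain → Literature.NumberTheory.Transcendental.KZ.of r - Literature.NumberTheory.Transcendental.KZ.of r' ∈ S) → (∀ a : ℚ, 0 < a → a < 1 → ∀ (r : Literature.NumberTheory.Transcendental.KZ.IntegralRep 1) (p : Literature.NumberTheory.Transcendental.KZ.IntegralRep 2), r.domain = {x | x 0 ∈ Set.Ioo (0:ℝ) 1} → Set.EqOn r.integrand (fun x => Real.sin (Real.pi * a) * (x 0) ^ ((a : ℝ) - 1) * (1 - x 0) ^ (-(a : ℝ))) r.domain → p.domain = {z | z 0 ^ 2 + z 1 ^ 2 ≤ 1} → Set.EqOn p.integrand (fun _ => 1) p.domain → Literature.NumberTheory.Transcendental.KZ.of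 r - Literature.NumberTheory.Transcendental.KZ.of p ∈ S) → ∀ ⦃n m : ℕ⦄ (r : Literature.NumberTheory.Transcendental.KZ.IntegralRep n) (r' : Literature.NumberTheory.Transcendental.KZ.IntegralRep m), r.value = r'.value → Literature.NumberTheory.Transcendental.KZ.of r - Literature.NumberTheory.Transcendental.KZ.of r' ∈ S

/-- item stmt-KontsevichZagierPeriods-14367 · support · rank 9 · closed · proved by Summit.KontsevichZagierPeriods.KontsevichZagierPeriods.Theorems.compiledSectorGlue_proof @ c26f1f606469 (prover) · by planner
sources: KontsevichZagierPeriods2001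
[support] GLUE TO THE TARGET (NEW at rev 4, route-choice 2026-08-16; gate shape
route.target-unreachable — 'no item concludes the target AlgebraicFormTarget'): LegendreSector →
ZhouWanKPrimeCubed → ZetaEvenBKC → EulerReflectionRational → CompiledSectorKernel →
AlgebraicFormTarget. PROVABLE NOW, pure logic, no analysis: instantiate CompiledSectorKernel at S :=
KZ.relations with le_rfl; its four realisability hypotheses are then cruxes 2–5 verbatim
(`KZ.Equivalent r r'` unfolds by definition to `KZ.of r − KZ.of r' ∈ KZ.relations`) and its
conclusion is AlgebraicFormTarget verbatim. Planner's Sketch.lean (imports the route file; rc 0,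
axioms propext/Classical.choice/Quot.sound): `theorem compiledSectorGlue_holds : CompiledSectorGlue
:= by intro hL hZ hE hR hK n m r r' hv; exact hK _ le_rfl hL hZ hE hR r r' hv`; and `closes
(compiledSectorGlue_holds h₂ h₃ h₄ h₅ h₆) : KontsevichZagierPeriods` composes it with the deciding
theorem. A prover closes this item by landing that term in
Theorems/CompiledSubstitutionsCompiledSectorGlue.lean. [difficulty: provable-now] -/
@[route_item "route-KontsevichZagierPeriods-CompiledSubstitutions"]
def CompiledSectorGlue : Prop :=
  LegendreSector → ZhouWanKPrimeCubed → ZetaEvenBKC → EulerReflectionRational → CompiledSectorKernel → AlgebraicFormTarget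

/-- item stmt-KontsevichZagierPeriods-3384 · support · rank 9 · closed · proved by Summit.KontsevichZagierPeriods.CompiledSubstitutions.PiNormalisation.piNormalisation_proof @ 080e58746066 (prover) · by planner
sources: KontsevichZagierPeriods2001
[support] KZ eq. (1) (card D1): the three 1-dim textbook representations of π — [ℝ, 1/(1+x²)],
[(−1,1), 1/√(1−x²)], [(−1,1), 2√(1−x²)] — are each KZ-equivalent to the closed-unit-disc rep
[x²+y²≤1, 1] (KZ: "easily related"; polar area r dr dθ = d(r²/2)dθ with x = tan(θ/2): (p,q) ↦
(q/(√(p²+q²)+p), (p²+q²)/(1+t²)) has Jacobian 1 on the slit disc; Newton–Leibniz with primitive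
x√(1−x²) is KZ's own one-move example). Needed by every crux that lands on π. [difficulty:
provable-now] -/
@[route_item "route-KontsevichZagierPeriods-CompiledSubstitutions"]
def PiNormalisation : Prop :=
  ∀ (p : Literature.NumberTheory.Transcendental.KZ.IntegralRep 2), p.domain = {z | z 0 ^ 2 + z 1 ^ 2 ≤ 1} → Set.EqOn p.integrand (fun _ => 1) p.domain → (∀ (r : Literature.NumberTheory.Transcendental.KZ.IntegralRep 1), r.domain = Set.univ → Set.EqOn r.integrand (fun x => 1 / (1 + x 0 ^ 2)) r.domain → Literature.NumberTheory.Transcendental.KZ.Equivalent r p) ∧ (∀ (r : Literature.NumberTheory.Transcendental.KZ.IntegralRep 1), r.domain = {x | x 0 ∈ Set.Ioo (-1:ℝ) 1} → Set.EqOn r.integrand (fun x => 1 / Real.sqrt (1 - x 0 ^ 2)) r.domain → Literature.NumberTheory.Transcendental.KZ.Equivalent r p) ∧ (∀ (r : Literature.NumberTheory.Transcendental.KZ.IntegralRep 1), r.domain = {x | x 0 ∈ Set.Ioo (-1:ℝ) 1} → Set.EqOn r.integrand (fun x => 2 * Real.sqrt (1 - x 0 ^ 2)) r.domain → Literature.NumberTheory.Transcendental.KZ.Equivalent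 r p)

/-- item stmt-KontsevichZagierPeriods-3385 · support · rank 9 · closed · proved by Summit.KontsevichZagierPeriods.CompiledSubstitutions.FagnanoDoubling.FagnanoDoubling_proof @ f648441f8c8f (prover) · by planner
sources: MckeanMoll1999, KontsevichZagierPeriods2001
[support] genus-1 calibration of "group law = ONE change of variables" (card D4): 2∫₀^{1/2}
dr/√(1−r⁴) = ∫₀^{4√15/17} dr/√(1−r⁴) (both 1.0064188863…, checked): the lemniscatic doubling r ↦
2r√(1−r⁴)/(1+r⁴) is ℚ-semialgebraic, injective on (0,1/2) (below the critical point √(√2−1)), pulls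
dr/√(1−r⁴) back to 2dr/√(1−r⁴); one changeOfVariablesRel + integrand bookkeeping. [difficulty:
provable-now] -/
@[route_item "route-KontsevichZagierPeriods-CompiledSubstitutions"]
def FagnanoDoubling : Prop :=
  ∀ (r r' : Literature.NumberTheory.Transcendental.KZ.IntegralRep 1), r.domain = {x | x 0 ∈ Set.Ioo (0:ℝ) (1/2)} → Set.EqOn r.integrand (fun x => 2 / Real.sqrt (1 - x 0 ^ 4)) r.domain → r'.domain = {x | x 0 ∈ Set.Ioo (0:ℝ) (4 * Real.sqrt 15 / 17)} → Set.EqOn r'.integrand (fun x => 1 / Real.sqrt (1 - x 0 ^ 4)) r'.domain → Literature.NumberTheory.Transcendental.KZ.Equivalent r r'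

/-- item stmt-KontsevichZagierPeriods-3386 · support · rank 9 · closed · proved by Summit.KontsevichZagierPeriods.CompiledSubstitutions.TanHalfAngleSemialgebraic.tanHalfAngleSemialgebraic_proof @ 537a707c9af3 (prover) · by planner
sources: BochnakCosteRoy1998, KontsevichZagierPeriods2001, Elkies2003
[support] the genus-0 compilation lemma (card U1): for every rational angle polyhedron A = {u ∈
(−π,π)ⁿ : Σᵢ aⱼᵢuᵢ < bⱼπ ∀j} (a ∈ ℤ^{m×n}, b ∈ ℚ^m), its image under t = tan(u/2) coordinatewise is
ℚ-semialgebraic. Proof: e^{iΣaᵢuᵢ} = ∏((1+itᵢ)/(1−itᵢ))^{aᵢ}, so each level set {Σaᵢuᵢ = bⱼπ + 2πℓ}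
is open-closed in a real algebraic set defined over ℚ(cos bⱼπ, sin bⱼπ) ⊂ ℚ̄∩ℝ, hence a union of its
(finitely many, semialgebraic) connected components; the sublevel set is a union of components of
the complement; real-algebraic parameters are ℚ-definable. [difficulty: M] -/
@[route_item "route-KontsevichZagierPeriods-CompiledSubstitutions"]
def TanHalfAngleSemialgebraic : Prop :=
  ∀ (n m : ℕ) (a : Fin m → Fin n → ℤ) (b : Fin m → ℚ), Literature.ModelTheory.ExponentialFields.IsSemialgebraic ℚ ((fun u : Fin n → ℝ => fun i => Real.tan (u i / 2)) '' {u : Fin n → ℝ | (∀ i, u i ∈ Set.Ioo (-Real.pi) Real.pi) ∧ ∀ j, ∑ i, (a j i : ℝ) * u i < (b j : ℝ) * Real.pi})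

/-- item stmt-KontsevichZagierPeriods-14464 · assembly · rank 1 · closed · proved by Summit.KontsevichZagierPeriods.KontsevichZagierPeriods.Theorems.cruxAssembly_proof @ be8325a1d3b9 (prover) · by planner
sources: KontsevichZagierPeriods2001
[assembly] CRUX-LEVEL ASSEMBLY (rev 5, route-choice 2026-08-16; supersedes the rev-0 Assembly
stmt-3387 `AlgebraicFormTarget → KontsevichZagierPeriods`, which the gate's ground probe flags
`ground.trivial: tauto` and which duplicated the deciding theorem `closes` verbatim): LegendreSector
→ ZhouWanKPrimeCubed → ZetaEvenBKC → EulerReflectionRational → CompiledSectorKernel →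
KontsevichZagierPeriods — cruxes 2–6 assemble to the summit. Provable now as `closes ∘
CompiledSectorGlue`: `fun h₂ h₃ h₄ h₅ h₆ => closes (glue h₂ h₃ h₄ h₅ h₆)` with `glue :
CompiledSectorGlue := fun hL hZ hE hR hK _ _ r r' hv => hK _ le_rfl hL hZ hE hR r r' hv` (planner's
Sketch.lean `cruxAssembly_holds`, axioms propext/Classical.choice/Quot.sound). [difficulty:
provable-now] -/
@[route_item "route-KontsevichZagierPeriods-CompiledSubstitutions"]
def CruxAssembly : Prop :=
  LegendreSector → ZhouWanKPrimeCubed → ZetaEvenBKC → EulerReflectionRational → CompiledSectorKernel → KontsevichZagierPeriods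

-- records of items no longer active in this route (dropped / restated):
-- earlier Assembly (stmt-KontsevichZagierPeriods-3387, replaced 2026-08-16T03:27:32Z -> stmt-KontsevichZagierPeriods-14464): retired by None — AlgebraicFormTarget → KontsevichZagierPeriods

/-! D-0027 §2.1 — DECIDING THEOREM (planner-authored via `route open/edit --closes-file`; by planner-rbadge-KontsevichZagierPeriods-Compile-9f2f398c-g2-0 2026-08-15T16:13:59Z):
its hypotheses are this route's items and its conclusion the sub-problem Statement (glue_lint), and it elaborates with this file. -/

/-- Deciding theorem (D-0027 §2.1) of route CompiledSubstitutions: the target item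
`AlgebraicFormTarget` — Conjecture 1 with algebraic (ℚ-semialgebraic) data, i.e. any two integral
representations of the KZ calculus with the same value are KZ-equivalent — implies the KZ-literal
summit `KontsevichZagierPeriods` (= `Literature.Periods.KZPeriodConjecture`, the same conclusion
under the two extra `IsRational` hypotheses) by dropping those hypotheses. The converse direction
(`kzPeriodConjecture'_iff_isRational`) is not needed here. -/
@[closes "route-KontsevichZagierPeriods-CompiledSubstitutions"] theorem closes (h₀ : AlgebraicFormTarget) : KontsevichZagierPeriods :=
  fun _ _ r r' _ _ hv => h₀ r r' hv

end Summit.KontsevichZagierPeriods.KontsevichZagierPeriods.Theses.CompiledSubstitutions
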